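import Summits.BirchSwinnertonDyer.BirchSwinnertonDyer.Theses.TameQuarticSolvent
import Summits.BirchSwinnertonDyer.BirchSwinnertonDyer.Theorems.TameQuarticSolventSolventPairLowerBoundStubGoodReduction
import Summits.BirchSwinnertonDyer.BirchSwinnertonDyer.Theorems.TameQuarticSolventSolventPairLowerBoundTwistDatumOfFriedbergHoffstein
import Summits.BirchSwinnertonDyer.BirchSwinnertonDyer.Theorems.TameQuarticSolventSolventPairLowerBoundPairGivenGoodFieldOf
import HarnessLib

/-!
# Route `TameQuarticSolvent`, crux `SolventPairLowerBound` (stmt-BirchSwinnertonDyer-21391), line `birth`: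
# the ROUTE DECL from six published inputs and the two open stubs K1, K2a — the birth skeleton v4 without `sorry`

HONEST FRAMING. Theorems only (`--supports stmt-BirchSwinnertonDyer-21391 --as helper`, lead `bsd-wall-tqs-p1`).
This file does NOT close the crux: it is the CONDITIONAL form of the registered skeleton of record
(`Cruxes/SolventPairLowerBound/Lines/birth.lean` v4, stubs `stub_publishedInputs`, `stub_exactBSD3OverSolventQuartic`,
`stub_kolyvaginTwistedUpperOverK`), with the three `sorry`s turned into hypotheses, so that the tree records — kernel
checked and sorry-free — exactly what the line has reduced the crux to:
* six PUBLISHED inputs, by name (tree named facts, not prover targets): modularity in two shapes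
  (`exists_isNewformOf`, `nonempty_modularParametrizationData`; Breuil–Conrad–Diamond–Taylor), Gross–Zagier 1986
  Thm. I.(7.3) (`GrossZagier1986_thm_I_7_3`), Gross–Zagier–Kolyvagin (`rank_eq_analyticRank_of_analyticRank_le_one`),
  Dokchitser–Dokchitser 2010 Thm. 2.3 `p`-part / Milne 1972 (`Milne1972.bsdQuotientP_baseChange_relQuadratic_anyModel`),
  Friedberg–Hoffstein 1995 Thm. B(1) in the real `3`-ramified class
  (`friedbergHoffstein_exists_pos_twist_ne_zero_ramifiedAtThree`);
* `hK1` — EXACT `BSD₃` OF `E` OVER THE TOTALLY REAL TAME QUARTIC (the registered stub `stub_exactBSD3OverSolventQuartic`,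
  verbatim): OPEN, conjecture-grade (signed two-variable Iwasawa theory over a base with `e(w|3) = 4 > p − 1`; implied
  by BSD for `E/M`). By the landed rungs the curve `E_M` there has GOOD SUPERSINGULAR reduction with `a_w = 0` at the
  unique `w ∣ 3` (`stub_goodReduction`, `frobeniusTraceAt_baseChange_eq_zero_of_subTprime_of_finrank_eq_four`);
* `hK2a` — the KOLYVAGIN UPPER BOUND FOR THE TWISTED CONSTITUENT `E_K ⊗ χ_β` over `K = ℚ(√d)` with the analytic
  choice of `β` folded in (the registered stub `stub_kolyvaginTwistedUpperOverK`, verbatim): print-grade inputs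
  (Friedberg–Hoffstein over `K`, Kolyvagin–Logachëv / Zhang / Nekovář over the real quadratic `K`, `Ш_an ∈ ℚ`), not
  in the tree.
Everything else of the line is PROVED in the sibling files: the admissible twist datum
(`stub_twistDatum_of_friedbergHoffstein`), the lever (`stub_goodReduction`), the solvent field and the Artin–Milne
squeeze (`stub_pairGivenGoodField_of`). When the planner files K1 / K2a as items with these signatures, the crux
follows from them by this theorem in one line. BSD is not proved by any of this.
-/

-- D-0017: single-problem summit, so `Summit.BirchSwinnertonDyer.BirchSwinnertonDyer.…` repeats a namespace BY DESIGN.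
set_option linter.dupNamespace false

noncomputable section

open scoped Classical NumberField

open IsDedekindDomain IsDedekindDomain.HeightOneSpectrum NumberField WeierstrassCurve
  Literature.NumberTheory.EllipticCurves Literature.NumberTheory.EllipticCurves.ModularForms
  Literature.NumberTheory.EllipticCurves.Rank1Residual

namespace Summit.BirchSwinnertonDyer.BirchSwinnertonDyer.Theorems.SolventPairLowerBound

/-- **Crux `SolventPairLowerBound` from six published inputs, K1 and K2a** (the birth skeleton v4 with its three
`sorry`s as hypotheses; composition `stub_twistDatum_of_friedbergHoffstein` → `stub_goodReduction` →
`stub_pairGivenGoodField_of`). `hK1` = registered stub `stub_exactBSD3OverSolventQuartic` (exact `BSD₃(E_M/M)` over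
every totally real tame quartic `M ⊃ K ⊃ ℚ` with `e(w|3) = 4` and good reduction above `3`; OPEN), `hK2a` =
registered stub `stub_kolyvaginTwistedUpperOverK` (a totally positive `β ∈ K = ℚ(√d)` of odd valuation above `3`
whose twisted constituent `(E_K)^{(β)}` has entire `L`-function, rational `#Ш_an`, finite `Ш[3^∞]` and
`ord₃ #Ш[3^∞] ≤ ord₃ #Ш_an`). CONDITIONAL on all eight hypotheses; credits nothing toward closing the item.
[cite: DokchitserDokchitserAnnals2010, §2.1 Thm. 2.3] [cite: FriedbergHoffstein1995, Thm. B (1)]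
[cite: GrossZagier1986, Thm. I.(7.3)] [cite: Milne1972ArithmeticAV, §1 Thm. 1] -/
theorem solventPairLowerBound_of_published_of_K1_of_K2a
    (hmod : exists_isNewformOf) (hmodP : nonempty_modularParametrizationData)
    (hGZ : GrossZagier1986_thm_I_7_3) (hGZK : rank_eq_analyticRank_of_analyticRank_le_one)
    (hDD : Milne1972.bsdQuotientP_baseChange_relQuadratic_anyModel)
    (hFH : friedbergHoffstein_exists_pos_twist_ne_zero_ramifiedAtThree)
    (hK1 : ∀ (W : WeierstrassCurve ℚ) [W.IsElliptic] [W.IsGloballyMinimal],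
      ¬ W.HasCM → Addv W 3 → Summit.BirchSwinnertonDyer.Rank1Residual.Additive.SubTprime W 3 →
      W.analyticRank = 1 →
      ∀ (K : Type) [Field K] [NumberField K] (M : Type) [Field M] [NumberField M] [Algebra K M],
        Module.finrank ℚ K = 2 → Module.finrank K M = 2 → IsTotallyReal M →
        (∀ w : HeightOneSpectrum (𝓞 M), ((3 : ℕ) : 𝓞 M) ∈ w.asIdeal →
          w.asIdeal.ramificationIdx ℤ = 4) →
        (∀ w : HeightOneSpectrum (𝓞 M), ((3 : ℕ) : 𝓞 M) ∈ w.asIdeal →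
          (W.baseChange M).HasGoodReductionAt w) →
        BSDpOver (W.baseChange M) 3)
    (hK2a : ∀ (W : WeierstrassCurve ℚ) [W.IsElliptic] [W.IsGloballyMinimal],
      ¬ W.HasCM → Addv W 3 → Summit.BirchSwinnertonDyer.Rank1Residual.Additive.SubTprime W 3 →
      W.analyticRank = 1 →
      ∀ (d : ℤ), 0 < d → padicValInt 3 d = 1 →
      ∀ (K : Type) [Field K] [NumberField K] (θ₁ : K), Module.finrank ℚ K = 2 → θ₁ ^ 2 = (d : K) →
        ∃ β : K,
          (∀ v : HeightOneSpectrum (𝓞 K), ((3 : ℕ) : 𝓞 K) ∈ v.asIdeal →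
            ∃ k : ℤ, v.valuation K β = WithZero.exp (2 * k + 1)) ∧
          (∀ σ : K →+* ℝ, 0 < σ β) ∧
          ∃ (Vβ : WeierstrassCurve K) (_ : Vβ.IsElliptic),
            (∃ C : WeierstrassCurve.VariableChange K, C • (W.baseChange K).quadraticTwist β = Vβ) ∧
            Vβ.HasEntireLFunction ∧
            Finite (AddCommGroup.primaryComponent Vβ.sha 3) ∧
            ∃ qβ : ℚ, analyticSha Vβ = (qβ : ℂ) ∧
              (padicValNat 3 (Nat.card (AddCommGroup.primaryComponent Vβ.sha 3)) : ℤ) ≤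
                padicValRat 3 qβ) :
    Summit.BirchSwinnertonDyer.BirchSwinnertonDyer.Theses.TameQuarticSolvent.SolventPairLowerBound := by
  intro W _ _ hCM hadd hsub hr
  obtain ⟨d, Wd, i1, i2, hd, hv, htw, hCMd, haddd, hsubd, hr0⟩ :=
    stub_twistDatum_of_friedbergHoffstein hmod hFH W hCM hadd hsub hr
  exact ⟨d, Wd, i1, i2, hd, hv, htw, hCMd, haddd, hsubd, hr0,
    stub_pairGivenGoodField_of hDD hmod hmodP hGZ hGZK hK1 hK2a W hCM hadd hsub hr
      (stub_goodReduction W hadd hsub) d Wd hd hv htw hCMd haddd hsubd hr0⟩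

end Summit.BirchSwinnertonDyer.BirchSwinnertonDyer.Theorems.SolventPairLowerBound

end
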